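import Summits.BirchSwinnertonDyer.BirchSwinnertonDyer.Theorems.PrintCf2SplitBadEisensteinTwoDisplay
import Summits.BirchSwinnertonDyer.BirchSwinnertonDyer.Theorems.CongruentShaFreeCutCharacterSupply
import HarnessLib

/-!
# Crux `PrintCf2.SplitBadTwoRankOneOfFacts` (item 20368), line `eisenstein_two_bdp_line` (skeleton of record d31d09ce), cut D2b of
# `stub_descent_two`, part 2: EVERY ♭-frame at an additive prime takes the value `u·(log_{ω_E} P / c)²`, `‖u‖ = ‖2‖_p`, at `𝟙` —
# every prime, GRANTED an interpolation supply; the literal `p = 2` instance (`‖u‖₂ = 1/2`)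

Cell `bsd-print-cf2`, seat `bsd-line-cf2-p1-w2` (prover, width seat on crux stmt-BirchSwinnertonDyer-20368; lead `bsd-line-cf2-p1` g5).
`--supports stmt-BirchSwinnertonDyer-20368` (helper). Theses-free; THEOREMS ONLY (0 definitions, 0 named facts, 0 `sorry`); CONDITIONAL on
`hL : LiuZhangZhang2018.thm151_thm153_modularCurve_heegnerVector_additive` (a conjunct of the line's `stub_prints_two`) ONLY. The
interpolation SUPPLY through `κ`, which the X11b road proves for odd `p` only (`X11b.exists_interpolationSupply_pow`: its λ-supply uses
`x² = 1 ⟹ x = 1` for principal units), is first taken as a hypothesis in the verbatim shape (§2a) and then DISCHARGED AT EVERY PRIME by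
cell bsd-cn100's port `CongruentShaFreeCutCharacterSupply.characterSupplyAt` (bsd-cn100-transfer g8; type-`(m₀,−m₀)` λ-supply, same
binder shape; §2b). Companion of `PrintCf2SplitBadEisensteinTwoDisplay.lean` (§1: the display for every `p`, `‖u‖ = ‖2‖_p`). BSD is
proved for no curve by any of this; no summit statement is proved by this seat.

* `intSeries_value_of_frame_manin_of_supply` — every `p`: frame `(Ω_K′, Ω_p′, Q′)` with `R1.IsBDPLFunctionInt` + supply ⟹
  `Q′(𝟙) = u·(log_ω P/c)²`, `‖u‖ = ‖2‖_p` (X11b's PRIME-FREE one-sided rigidity `intSeries_constantCoeff_eq_of_isBDPLFunctionInt_of_tendsto`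
  against §1's continuous display on the supply's two families).
* `intSeries_value_of_frame_manin_two_of_supply` — `p = 2`, the datum's own newform `Dt.f`: `‖u‖₂ = 1/2`.
* `intSeries_value_of_frame_manin_anyPrime` — every `p`, NO supply hypothesis (bsd-cn100's any-prime character supply): the odd-`p`
  theorem `UniversalToricDescentWaldspurgerFlat.intSeries_value_of_frame_manin` with `p ≠ 2` REMOVED and `‖u‖ = 1 ↦ ‖u‖ = ‖2‖_p`.
* **`intSeries_value_of_frame_manin_two`** — `p = 2`, `Dt.f`, no supply hypothesis: EVERY frame that `stub_existsIntegralBDP_two`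
  supplies satisfies `Q(𝟙) = u·(log_{ω_E} P/c)²`, `‖u‖₂ = 1/2`, i.e. `ord₂ Q(𝟙) = 1 + 2·ord₂ log_{ω_E} P − 2·ord₂ c` — the «LZZ
  `2^{1−2n}(2/h_K)²·u_K·c²` bookkeeping» of the lead's cut D2b, as ONE net factor `2`, CLOSED modulo `hL`.

References: [LiuZhangZhang2018] Duke Math. J. 167 (2018) Thm 1.5.1, Thm 1.5.3; [Castella2018] Thms. 3.1–3.2 (shapes); [CastellaHsieh2018]
§3.3; [Washington1997] §7.1; [Greenberg1987] §2.
-/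

set_option autoImplicit false

-- D-0017 layout: summit = sub-problem, so `Summit.BirchSwinnertonDyer.BirchSwinnertonDyer.…` is the mandated namespace of Theorems files.
set_option linter.dupNamespace false

noncomputable section

open scoped Classical MatrixGroups ModularForm Topology NumberField

namespace Summit.BirchSwinnertonDyer.BirchSwinnertonDyer.Theorems.PrintCf2.EisensteinTwo

open Filter CongruenceSubgroup WeierstrassCurve NumberField IsDedekindDomain Field PowerSeries
  Literature.NumberTheory.EllipticCurves Literature.NumberTheory.EllipticCurves.ModularForms
  Literature.NumberTheory.EllipticCurves.LiuZhangZhang2018 Literature.NumberTheory.EllipticCurves.Rank1Residual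
  Literature.NumberTheory.GaloisRepresentations
  Summit.BirchSwinnertonDyer.Rank1Residual Summit.BirchSwinnertonDyer.Rank1Residual.X11b
  Summit.BirchSwinnertonDyer.Rank1Residual.X11b.Halves Summit.BirchSwinnertonDyer.Rank1Residual.X2
  Summit.BirchSwinnertonDyer.BirchSwinnertonDyer.Theorems.UniversalToricDescentWaldspurgerFlat

/-! ### §2 The value of EVERY ♭-frame at `𝟙`, every prime, granted an interpolation supply -/

section Frame

variable {p : ℕ} [Fact p.Prime]

/-- **The value at `𝟙` of every ♭-frame at an additive prime, Manin constant kept, EVERY prime `p`, GRANTED a supply.** For `W/ℚ`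
globally minimal with `p² ∣ N_W`, `K` imaginary quadratic with `d_K < −4` and the Heegner hypothesis for `N_W`, a Heegner datum
`(Dt, H, ι_K, P)` with `P` of INFINITE order, `(κ, γ)` anticyclotomic, a degree-one prime `𝔭 ∋ p`, an embedding datum `ι′` inducing `𝔭`,
a newform `f` of `W`, and an INTERPOLATION SUPPLY through `κ` — `m > 0`, `x₀` with `x₀^{p^k} → 1`, two families of everywhere-unramified
Hecke characters `φ_k`, `φ′_k` of types `(m p^k, −m p^k)`, `(2m p^k, −2m p^k)` with `p`-adic avatars `r_k`, `r′_k` through `κ` and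
`r_k(γ) = x₀^{p^k}`, `r′_k(γ) = x₀^{2p^k}` (VERBATIM the conclusion of `X11b.exists_interpolationSupply_pow`, which supplies it for odd
`p`) —: EVERY ♭-frame `(Ω_K′ ≠ 0, Ω_p′ ≠ 0, Q′)` with `R1.IsBDPLFunctionInt p ι′ 𝔭 κ γ f Ω_K′ Ω_p′ Q′` has `Q′(𝟙) = u·(log_{ω_E} P / c)²`
with `‖u‖ = ‖2‖_p`. Proof: §1's continuous display on the two families + X11b's prime-free one-sided rigidity
`intSeries_constantCoeff_eq_of_isBDPLFunctionInt_of_tendsto`. CONDITIONAL on `hL`; nothing booked.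
[cite: LiuZhangZhang2018, Thm 1.5.1 and Thm 1.5.3 (Duke Math. J. 167 pp. 748–749)]
[cite: Castella2018, Thm. 3.1–3.2 (arXiv:1704.06608 pp. 8–9) (shapes)] [cite: CastellaHsieh2018, §3.3, Def. 3.5 and Prop. 3.6] -/
theorem intSeries_value_of_frame_manin_of_supply
    (hL : thm151_thm153_modularCurve_heegnerVector_additive)
    (W : WeierstrassCurve ℚ) [W.IsElliptic] [W.IsGloballyMinimal]
    (K : Type) [Field K] [NumberField K] (𝔭 : HeightOneSpectrum (𝓞 K))
    (κ : ZpExtension K p) (γ : absoluteGaloisGroup K) [Fact (κ.IsTopGenerator γ)] {N : ℕ} [NeZero N]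
    (Dt : ModularParametrizationData W N) (H : HeegnerDatum N (NumberField.discr K))
    (ιK : K →+* ℂ) (P : (W.baseChange K).toAffine.Point)
    (f : CuspForm (CongruenceSubgroup.Gamma0 N) 2) (hfW : IsNewformOf W f)
    (hN : W.conductorNorm ℤ = N) (hp2N : p ^ 2 ∣ N) (hK : IsImaginaryQuadratic K)
    (hd4 : NumberField.discr K < -4)
    (h𝔭 : ((p : ℕ) : 𝓞 K) ∈ 𝔭.asIdeal) (he : 𝔭.asIdeal.ramificationIdx (𝓞 ℚ) = 1)
    (hf : 𝔭.asIdeal.inertiaDeg (𝓞 ℚ) = 1)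
    (hHN : SatisfiesHeegnerHypothesis N K) (hκ : κ.IsAnticyclotomic)
    (hP : WeierstrassCurve.Affine.Point.map ιK.toRatAlgHom P = heegnerPointComplex Dt H)
    (hPinf : ¬ IsOfFinAddOrder P)
    (ι' : PadicAlgCl p ≃+* ℂ)
    (hι' : ∀ (w : InfinitePlace K) (k : 𝓞 K), k ∈ 𝔭.asIdeal ↔ ‖ι'.symm (w.embedding (k : K))‖ < 1)
    -- the interpolation supply through `κ` (conclusion shape of `X11b.exists_interpolationSupply_pow`)
    (m : ℕ) (x₀ : ℂ_[p]) (φ φ' : ℕ → HeckeCharacter K) (r r' : ℕ → FramedGaloisRep K (PadicAlgCl p) 1)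
    (hm : 0 < m) (hx : Tendsto (fun k ↦ x₀ ^ p ^ k) atTop (𝓝 1))
    (hunr : ∀ k (v : HeightOneSpectrum (𝓞 K)), (φ k).IsUnramifiedAt v)
    (hinf : ∀ k, (φ k).HasInfinityType (fun _ ↦ ((m * p ^ k : ℕ) : ℤ)) (fun _ ↦ -((m * p ^ k : ℕ) : ℤ)))
    (hr : ∀ k, IsPAdicAvatarOf ι' (φ k) (r k)) (hrκ : ∀ k, FactorsThroughZp κ (r k))
    (hval : ∀ k, avatarValueAt (r k) γ = x₀ ^ p ^ k)
    (hunr' : ∀ k (v : HeightOneSpectrum (𝓞 K)), (φ' k).IsUnramifiedAt v)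
    (hinf' : ∀ k, (φ' k).HasInfinityType (fun _ ↦ ((2 * m * p ^ k : ℕ) : ℤ)) (fun _ ↦ -((2 * m * p ^ k : ℕ) : ℤ)))
    (hr' : ∀ k, IsPAdicAvatarOf ι' (φ' k) (r' k)) (hrκ' : ∀ k, FactorsThroughZp κ (r' k))
    (hval' : ∀ k, avatarValueAt (r' k) γ = x₀ ^ (2 * p ^ k))
    -- the frame
    {ΩK' : ℂ} {Ωp' : ℂ_[p]} {Q' : PowerSeries (PadicComplexInt p)} (hΩK' : ΩK' ≠ 0) (hΩp' : Ωp' ≠ 0)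
    (hQ' : R1.IsBDPLFunctionInt p ι' 𝔭 κ γ f ΩK' Ωp' Q') :
    ∃ u : ℂ_[p], ‖u‖ = ‖(2 : ℂ_[p])‖ ∧ IntSeries.HasValueAt Q' 0
      (u * (algebraMap ℚ_[p] ℂ_[p] (logOmega W p (embAt K p 𝔭 h𝔭 he hf) P / (Dt.c : ℚ_[p]))) ^ 2) := by
  have hp : p.Prime := Fact.out
  have hγ : κ.IsTopGenerator γ := Fact.out
  have hpN : p ∣ N := dvd_trans (dvd_pow_self p two_ne_zero) hp2N
  have hsplit : ((Ideal.span {(p : ℤ)}).primesOver (𝓞 K)).ncard = 2 := hHN p hp hpN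
  set e : K →+* ℚ_[p] := embAt K p 𝔭 h𝔭 he hf with hedef
  have hemb : ∀ k : 𝓞 K, k ∈ 𝔭.asIdeal ↔ ‖e (k : K)‖ < 1 := mem_asIdeal_iff_norm_embAt_lt_one 𝔭 h𝔭 he hf
  -- §1: the continuous display at the embedding of the frame's prime
  obtain ⟨Ωp₀, u, hΩp₀, hu, hcont⟩ :=
    exists_continuousDisplay_manin_anyPrime hL ι' W K 𝔭 κ γ Dt H ιK e P f hN hp2N hK hd4 hsplit h𝔭 hι' hHN hκ hγ hfW hP hemb
  have hlog : Castella2018.padicLogOmega W p e P = logOmega W p e P := (R1.logOmega_eq_padicLogOmega W p e P).symm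
  rw [hlog] at hcont
  -- the limit is non-zero: `P` of infinite order, `c ≠ 0`, `u ≠ 0`
  have hlogne : logOmega W p e P ≠ 0 := R1.logOmega_ne_zero W p e hPinf
  have hcZ : Dt.c ≠ 0 := Dt.maninConstant_ne_zero_holds
  have hcQ : (Dt.c : ℚ_[p]) ≠ 0 := by exact_mod_cast hcZ
  have hu0 : u ≠ 0 := fun h0 ↦ by
    rw [h0, norm_zero] at hu
    exact (norm_pos_iff.mpr (two_ne_zero : (2 : ℂ_[p]) ≠ 0)).ne hu
  have hc0 : u * (algebraMap ℚ_[p] ℂ_[p] (logOmega W p e P / (Dt.c : ℚ_[p]))) ^ 2 ≠ 0 :=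
    mul_ne_zero hu0 (pow_ne_zero _ ((map_ne_zero _).mpr (div_ne_zero hlogne hcQ)))
  -- the two families of the supply have `r(γ) → 1`
  have hn : ∀ k, 0 < m * p ^ k := fun k ↦ Nat.mul_pos hm (pow_pos hp.pos k)
  have hn' : ∀ k, 0 < 2 * m * p ^ k := fun k ↦ Nat.mul_pos (Nat.mul_pos two_pos hm) (pow_pos hp.pos k)
  have hlim : Tendsto (fun k ↦ avatarValueAt (r k) γ) atTop (𝓝 1) := by
    simp_rw [hval]; exact hx
  have hlim' : Tendsto (fun k ↦ avatarValueAt (r' k) γ) atTop (𝓝 1) := by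
    simp_rw [hval']
    have h2 : Tendsto (fun k ↦ (x₀ ^ p ^ k) ^ 2) atTop (𝓝 1) := by simpa using hx.pow 2
    refine h2.congr fun k ↦ ?_
    ring
  have hv := hcont (fun k ↦ φ k) (fun k ↦ m * p ^ k) r hn hunr hinf hr hrκ hlim
  have hw := hcont (fun k ↦ φ' k) (fun k ↦ 2 * m * p ^ k) r' hn' hunr' hinf' hr' hrκ' hlim'
  -- X11b's prime-free one-sided rigidity
  have heq := intSeries_constantCoeff_eq_of_isBDPLFunctionInt_of_tendsto K N ι' 𝔭 κ γ f 1 ΩK' Ωp₀ Ωp' Q' m x₀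
    φ φ' r r' _ hm hx hunr hinf hr hrκ hval hunr' hinf' hr' hrκ' hval' one_ne_zero hΩK' hΩp₀ hΩp' hv hw hc0 hQ'
  refine ⟨u, hu, ?_⟩
  rw [← heq]
  exact R1.intSeries_hasValueAt_zero p Q'

/-- **The literal `p = 2` instance for the line** (`4 ∣ N_W`, i.e. `W` additive at `2`; `2` split in `K″` by the Heegner hypothesis):
every ♭-frame of the datum's newform `Dt.f` at `2` — the object `stub_existsIntegralBDP_two` supplies — takes at `𝟙` the value
`u·(log_{ω_E} P / c)²` with `‖u‖₂ = 1/2`, granted the `2`-adic interpolation supply through `κ`. So, in `stub_descent_two`'s descent,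
the analytic side contributes `ord₂ Q(𝟙) = 1 + 2·ord₂(log_{ω_E} P) − 2·ord₂ c` (the Manin constant `c = Dt.c`).
[cite: LiuZhangZhang2018, Thm 1.5.1 and Thm 1.5.3 (Duke Math. J. 167 pp. 748–749)] [cite: CastellaHsieh2018, §3.3, Def. 3.5 and Prop. 3.6] -/
theorem intSeries_value_of_frame_manin_two_of_supply
    (hL : thm151_thm153_modularCurve_heegnerVector_additive)
    (W : WeierstrassCurve ℚ) [W.IsElliptic] [W.IsGloballyMinimal]
    (K : Type) [Field K] [NumberField K] (𝔭 : HeightOneSpectrum (𝓞 K))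
    (κ : ZpExtension K 2) (γ : absoluteGaloisGroup K) [Fact (κ.IsTopGenerator γ)] {N : ℕ} [NeZero N]
    (Dt : ModularParametrizationData W N) (H : HeegnerDatum N (NumberField.discr K))
    (ιK : K →+* ℂ) (P : (W.baseChange K).toAffine.Point)
    (hN : W.conductorNorm ℤ = N) (h4N : 2 ^ 2 ∣ N) (hK : IsImaginaryQuadratic K)
    (hd4 : NumberField.discr K < -4)
    (h𝔭 : ((2 : ℕ) : 𝓞 K) ∈ 𝔭.asIdeal) (he : 𝔭.asIdeal.ramificationIdx (𝓞 ℚ) = 1)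
    (hf : 𝔭.asIdeal.inertiaDeg (𝓞 ℚ) = 1)
    (hHN : SatisfiesHeegnerHypothesis N K) (hκ : κ.IsAnticyclotomic)
    (hP : WeierstrassCurve.Affine.Point.map ιK.toRatAlgHom P = heegnerPointComplex Dt H)
    (hPinf : ¬ IsOfFinAddOrder P)
    (ι' : PadicAlgCl 2 ≃+* ℂ)
    (hι' : ∀ (w : InfinitePlace K) (k : 𝓞 K), k ∈ 𝔭.asIdeal ↔ ‖ι'.symm (w.embedding (k : K))‖ < 1)
    (m : ℕ) (x₀ : ℂ_[2]) (φ φ' : ℕ → HeckeCharacter K) (r r' : ℕ → FramedGaloisRep K (PadicAlgCl 2) 1)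
    (hm : 0 < m) (hx : Tendsto (fun k ↦ x₀ ^ 2 ^ k) atTop (𝓝 1))
    (hunr : ∀ k (v : HeightOneSpectrum (𝓞 K)), (φ k).IsUnramifiedAt v)
    (hinf : ∀ k, (φ k).HasInfinityType (fun _ ↦ ((m * 2 ^ k : ℕ) : ℤ)) (fun _ ↦ -((m * 2 ^ k : ℕ) : ℤ)))
    (hr : ∀ k, IsPAdicAvatarOf ι' (φ k) (r k)) (hrκ : ∀ k, FactorsThroughZp κ (r k))
    (hval : ∀ k, avatarValueAt (r k) γ = x₀ ^ 2 ^ k)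
    (hunr' : ∀ k (v : HeightOneSpectrum (𝓞 K)), (φ' k).IsUnramifiedAt v)
    (hinf' : ∀ k, (φ' k).HasInfinityType (fun _ ↦ ((2 * m * 2 ^ k : ℕ) : ℤ)) (fun _ ↦ -((2 * m * 2 ^ k : ℕ) : ℤ)))
    (hr' : ∀ k, IsPAdicAvatarOf ι' (φ' k) (r' k)) (hrκ' : ∀ k, FactorsThroughZp κ (r' k))
    (hval' : ∀ k, avatarValueAt (r' k) γ = x₀ ^ (2 * 2 ^ k))
    {ΩK' : ℂ} {Ωp' : ℂ_[2]} {Q' : PowerSeries (PadicComplexInt 2)} (hΩK' : ΩK' ≠ 0) (hΩp' : Ωp' ≠ 0)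
    (hQ' : R1.IsBDPLFunctionInt 2 ι' 𝔭 κ γ Dt.f ΩK' Ωp' Q') :
    ∃ u : ℂ_[2], ‖u‖ = 2⁻¹ ∧ IntSeries.HasValueAt Q' 0
      (u * (algebraMap ℚ_[2] ℂ_[2] (logOmega W 2 (embAt K 2 𝔭 h𝔭 he hf) P / (Dt.c : ℚ_[2]))) ^ 2) := by
  obtain ⟨u, hu, hv⟩ := intSeries_value_of_frame_manin_of_supply (p := 2) hL W K 𝔭 κ γ Dt H ιK P Dt.f Dt.isNewformOf hN h4N
    hK hd4 h𝔭 he hf hHN hκ hP hPinf ι' hι' m x₀ φ φ' r r' hm hx hunr hinf hr hrκ hval hunr' hinf' hr' hrκ' hval' hΩK' hΩp' hQ'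
  refine ⟨u, ?_, hv⟩
  rw [hu]
  have h : ‖((2 : ℕ) : ℂ_[2])‖ = ((2 : ℕ) : ℝ)⁻¹ := by
    rw [← map_natCast (algebraMap ℚ_[2] ℂ_[2]) 2, norm_algebraMap', Padic.norm_p]
  simpa using h

/-- **The value at `𝟙` of every ♭-frame at an additive prime — EVERY prime `p`, NO supply hypothesis.** The odd-`p` theorem
`UniversalToricDescentWaldspurgerFlat.intSeries_value_of_frame_manin` with `p ≠ 2` removed (and `‖u‖ = 1 ↦ ‖u‖ = ‖2‖_p`): the supply is
cell bsd-cn100's any-prime `CongruentShaFreeCutCharacterSupply.characterSupplyAt`. CONDITIONAL on `hL` only.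
[cite: LiuZhangZhang2018, Thm 1.5.1 and Thm 1.5.3 (Duke Math. J. 167 pp. 748–749)]
[cite: Castella2018, Thm. 3.1–3.2 (arXiv:1704.06608 pp. 8–9) (shapes)] [cite: Weil1956, §1–§2] [cite: Greenberg1987, §2] -/
theorem intSeries_value_of_frame_manin_anyPrime
    (hL : thm151_thm153_modularCurve_heegnerVector_additive)
    (W : WeierstrassCurve ℚ) [W.IsElliptic] [W.IsGloballyMinimal]
    (K : Type) [Field K] [NumberField K] (𝔭 : HeightOneSpectrum (𝓞 K))
    (κ : ZpExtension K p) (γ : absoluteGaloisGroup K) [Fact (κ.IsTopGenerator γ)] {N : ℕ} [NeZero N]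
    (Dt : ModularParametrizationData W N) (H : HeegnerDatum N (NumberField.discr K))
    (ιK : K →+* ℂ) (P : (W.baseChange K).toAffine.Point)
    (f : CuspForm (CongruenceSubgroup.Gamma0 N) 2) (hfW : IsNewformOf W f)
    (hN : W.conductorNorm ℤ = N) (hp2N : p ^ 2 ∣ N) (hK : IsImaginaryQuadratic K)
    (hd4 : NumberField.discr K < -4)
    (h𝔭 : ((p : ℕ) : 𝓞 K) ∈ 𝔭.asIdeal) (he : 𝔭.asIdeal.ramificationIdx (𝓞 ℚ) = 1)
    (hf : 𝔭.asIdeal.inertiaDeg (𝓞 ℚ) = 1)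
    (hHN : SatisfiesHeegnerHypothesis N K) (hκ : κ.IsAnticyclotomic)
    (hP : WeierstrassCurve.Affine.Point.map ιK.toRatAlgHom P = heegnerPointComplex Dt H)
    (hPinf : ¬ IsOfFinAddOrder P)
    (ι' : PadicAlgCl p ≃+* ℂ)
    (hι' : ∀ (w : InfinitePlace K) (k : 𝓞 K), k ∈ 𝔭.asIdeal ↔ ‖ι'.symm (w.embedding (k : K))‖ < 1)
    {ΩK' : ℂ} {Ωp' : ℂ_[p]} {Q' : PowerSeries (PadicComplexInt p)} (hΩK' : ΩK' ≠ 0) (hΩp' : Ωp' ≠ 0)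
    (hQ' : R1.IsBDPLFunctionInt p ι' 𝔭 κ γ f ΩK' Ωp' Q') :
    ∃ u : ℂ_[p], ‖u‖ = ‖(2 : ℂ_[p])‖ ∧ IntSeries.HasValueAt Q' 0
      (u * (algebraMap ℚ_[p] ℂ_[p] (logOmega W p (embAt K p 𝔭 h𝔭 he hf) P / (Dt.c : ℚ_[p]))) ^ 2) := by
  have hγ : κ.IsTopGenerator γ := Fact.out
  obtain ⟨m, x₀, φ, φ', r, r', hm, -, hx, hunr, hinf, hr, hrκ, hval, hunr', hinf', hr', hrκ', hval'⟩ :=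
    CongruentShaFreeCutCharacterSupply.characterSupplyAt K ι' κ γ hK hκ hγ
  exact intSeries_value_of_frame_manin_of_supply hL W K 𝔭 κ γ Dt H ιK P f hfW hN hp2N hK hd4 h𝔭 he hf hHN hκ hP hPinf ι' hι'
    m x₀ φ φ' r r' hm hx hunr hinf hr hrκ hval hunr' hinf' hr' hrκ' hval' hΩK' hΩp' hQ'

/-- **D2b's analytic half at `p = 2`, CLOSED modulo Liu–Zhang–Zhang.** For `W/ℚ` globally minimal with `4 ∣ N_W` (additive at `2`), `K`
imaginary quadratic with `d_K < −4` and the Heegner hypothesis for `N_W` (so `2` splits in `K`), a Heegner datum `(Dt, H, ι_K, P)` with `P`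
of infinite order, `(κ, γ)` anticyclotomic at `2`, a degree-one `𝔭 ∣ 2` and an embedding datum `ι′` inducing `𝔭`: EVERY ♭-frame
`(Ω_K′ ≠ 0, Ω_p′ ≠ 0, Q′ ∈ 𝓞_{ℂ₂}⟦T⟧)` with `R1.IsBDPLFunctionInt 2 ι′ 𝔭 κ γ Dt.f Ω_K′ Ω_p′ Q′` — the object `stub_existsIntegralBDP_two`
of line `eisenstein_two_bdp_line` supplies — has `Q′(𝟙) = u·(log_{ω_E} P / c)²` with `‖u‖₂ = 1/2`: `ord₂ Q′(𝟙) = 1 + 2·ord₂ log_{ω_E} P −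
2·ord₂ c`. (At odd `p` the same road gives `‖u‖ = 1`; the net `2` is LZZ's `8/(s·w_K²·√|d_K|)` with `w_K = 2`.)
[cite: LiuZhangZhang2018, Thm 1.5.1 and Thm 1.5.3 (Duke Math. J. 167 pp. 748–749)] [cite: CastellaHsieh2018, §3.3, Def. 3.5 and Prop. 3.6] -/
theorem intSeries_value_of_frame_manin_two
    (hL : thm151_thm153_modularCurve_heegnerVector_additive)
    (W : WeierstrassCurve ℚ) [W.IsElliptic] [W.IsGloballyMinimal]
    (K : Type) [Field K] [NumberField K] (𝔭 : HeightOneSpectrum (𝓞 K))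
    (κ : ZpExtension K 2) (γ : absoluteGaloisGroup K) [Fact (κ.IsTopGenerator γ)] {N : ℕ} [NeZero N]
    (Dt : ModularParametrizationData W N) (H : HeegnerDatum N (NumberField.discr K))
    (ιK : K →+* ℂ) (P : (W.baseChange K).toAffine.Point)
    (hN : W.conductorNorm ℤ = N) (h4N : 2 ^ 2 ∣ N) (hK : IsImaginaryQuadratic K)
    (hd4 : NumberField.discr K < -4)
    (h𝔭 : ((2 : ℕ) : 𝓞 K) ∈ 𝔭.asIdeal) (he : 𝔭.asIdeal.ramificationIdx (𝓞 ℚ) = 1)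
    (hf : 𝔭.asIdeal.inertiaDeg (𝓞 ℚ) = 1)
    (hHN : SatisfiesHeegnerHypothesis N K) (hκ : κ.IsAnticyclotomic)
    (hP : WeierstrassCurve.Affine.Point.map ιK.toRatAlgHom P = heegnerPointComplex Dt H)
    (hPinf : ¬ IsOfFinAddOrder P)
    (ι' : PadicAlgCl 2 ≃+* ℂ)
    (hι' : ∀ (w : InfinitePlace K) (k : 𝓞 K), k ∈ 𝔭.asIdeal ↔ ‖ι'.symm (w.embedding (k : K))‖ < 1)
    {ΩK' : ℂ} {Ωp' : ℂ_[2]} {Q' : PowerSeries (PadicComplexInt 2)} (hΩK' : ΩK' ≠ 0) (hΩp' : Ωp' ≠ 0)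
    (hQ' : R1.IsBDPLFunctionInt 2 ι' 𝔭 κ γ Dt.f ΩK' Ωp' Q') :
    ∃ u : ℂ_[2], ‖u‖ = 2⁻¹ ∧ IntSeries.HasValueAt Q' 0
      (u * (algebraMap ℚ_[2] ℂ_[2] (logOmega W 2 (embAt K 2 𝔭 h𝔭 he hf) P / (Dt.c : ℚ_[2]))) ^ 2) := by
  obtain ⟨u, hu, hv⟩ := intSeries_value_of_frame_manin_anyPrime (p := 2) hL W K 𝔭 κ γ Dt H ιK P Dt.f Dt.isNewformOf hN h4N hK hd4
    h𝔭 he hf hHN hκ hP hPinf ι' hι' hΩK' hΩp' hQ'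
  refine ⟨u, ?_, hv⟩
  rw [hu]
  have h : ‖((2 : ℕ) : ℂ_[2])‖ = ((2 : ℕ) : ℝ)⁻¹ := by
    rw [← map_natCast (algebraMap ℚ_[2] ℂ_[2]) 2, norm_algebraMap', Padic.norm_p]
  simpa using h

end Frame

end Summit.BirchSwinnertonDyer.BirchSwinnertonDyer.Theorems.PrintCf2.EisensteinTwo

end
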